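import Literature.NumberTheory.Automorphic.FixedCosetsStableLattices       -- ★ `span_range_transpose_mul`, `span_range_transpose_eq_iff`, `glInt` currency
import Literature.NumberTheory.Automorphic.UnitaryGroupFormTransport        -- ★ `formCongr`, `unitaryGroupOfForm`
import HarnessLib

/-!
# The TREE of self-dual and `ϖ`-modular lattices of a unimodular hermitian plane over a valued field — DEFINITIONS
# (Bruhat–Tits 1972 §10; Serre, *Trees*, II.1.1; Jacobowitz 1962, §7–§8): vertices, adjacency, depth and parent towards the root `𝒪²`, the action of `U(σ, H)`

Topic `NumberTheory/Automorphic`; namespace `Literature.NumberTheory.Automorphic.HermitianLatticeTree`.  DEFINITIONS WITH BODIES + their unfolding ∕ bookkeeping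
lemmas (no named fact, no `sorry`, no instance, no notation).  Cell `pub/hodgecm-mathlib` (D-0151), crux H413 (stmt-HodgeConjecture-24833), line «N6nsGerm», the Euler–Poincaré road (R2) `stub_N6nsR2EP : RankOneEulerPoincareNonsplit` — a count-free proof of the ELLIPTIC relation (E) of ★ `Rogawski1990/RankOneEulerPoincareGlue` at every TAME non-split place, inert and ramified alike (A-p17 (g22) bytes (T1), co-hand A-p06 (g27) `F0/P3a/A-p06/g27/CENSUS-R2ram-RamifiedEulerPoincare.A-p06g27.md`, LEAD F0P3a-plan (g10) WORDS T9-6 ∕ T9-8).  HONEST LABEL: HC_CM is proved only modulo the printed citations until rung 0 closes; nothing printed is asserted here (elementary lattice algebra over a valuation ring).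

THE OBJECT.  `E` a field with a valuative relation (`𝒪 = 𝒪[E]`), `σ : E →+* E` (the conjugation of a quadratic extension `E ∕ F`; only used through the Gram
matrices), `ϖ ∈ E` (a uniformizer of `E`), `H ∈ M₂(E)` (a unimodular `σ`-hermitian matrix: the form).  LATTICES are written in the matrix ∕ `glInt` currency of ★
`FixedCosetsStableLattices` (the currency of the consumer, the (R2) assembly on `unitaryGroupOfForm σ H`): `latt g := 𝒪-span of the columns of g` (the
coordinate-free `HermitianLattice.IsUnimodularLattice` of ★ `HermitianLatticesLocal` — sesquilinear forms on `Valued K ℤᵐ⁰` — is the same notion of self-duality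
but is not used here: the tree needs only Gram matrices).  A lattice `latt g` is SELF-DUAL if its Gram matrix `formCongr σ g H = (σg)ᵀ H g` is
UNIMODULAR (integral with unit determinant) and `ϖ`-MODULAR if `ϖ⁻¹ · (σg)ᵀ H g` is unimodular (i.e. `Λ^∨ = ϖ⁻¹Λ`).  The graph `latticeTree σ ϖ H` has the
self-dual and the `ϖ`-modular lattices as vertices and an edge `L — Λ` whenever `ϖL ≤ Λ ≤ L` (`L` self-dual, `Λ` `ϖ`-modular).  At an INERT place of `E ∕ F`
(`ϖ ∈ F`) this is the Bruhat–Tits tree of `U(H) ≅ U(1,1)(F)` itself (two vertex types, stabilisers `K = Stab(𝒪²)`, `K′ = Stab(𝒪e₁ ⊕ ϖ𝒪e₂)`, edges ↔ Iwahori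
cosets); at a TAME RAMIFIED place (`σϖ = −ϖ`) it is the BARYCENTRIC SUBDIVISION of the tree of `U(H)`: the `ϖ`-modular lattices are the vertices (valency
`q+1`), the self-dual ones the edge midpoints (valency `2`), the edges the half-edges (A-p06 (g27) ∕ A-p17 (g22) 08:23–08:27Z).  ROOTED STRUCTURE at the
self-dual root `L₀ = 𝒪² = latt 1`: `latticeDepth ϖ M = min {k | ϖ^k L₀ ≤ M}` and `latticeParent σ ϖ H M = M^♮ ⊓ ϖ^{1−k} L₀` (`M^♮ = M` for self-dual, `ϖ⁻¹M` for
`ϖ`-modular `M`, `k` the depth) — the neighbour of `M` towards the root; the tree property (connected through the parent chains, acyclic because every edge is a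
parent edge) is the sequel (`HermitianLatticeTreeDiagonal` → `…Frames` → `…Parent` → `…IsTree`: ★-to-be `isTree_latticeTree`).

* §1 `latt`, `scaleLattice`, `IsUnimodular₂`, `IsSelfDualLattice`, `IsModularLattice`, `IsSpecialLattice`.
* §2 `latticeTree σ ϖ H : SimpleGraph {M // IsSpecialLattice σ ϖ H M}` (+ `latticeTree_adj_iff`).
* §3 `latticeDepth`, `latticeParent`; §3b `latt_mul`, `scaleLattice_map`.
* §3c the action: `mapGL` (+ `mapGL_latt`, `mapGL_mul`, `mapGL_one`, `mapGL_le_mapGL_iff`, `mapGL_scaleLattice`), `formCongr_unitary_mul`, `isSelfDualLattice_mapGL`,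
  `isModularLattice_mapGL`, `isSpecialLattice_mapGL`, the permutation `latticeTreePerm` and the GRAPH AUTOMORPHISM **`latticeTreeIso σ ϖ H u`** of `u ∈ U(σ, H)`
  (+ `latticeTreeIso_apply_coe`), the type colouring **`latticeTreeColoring`** (self-dual ↦ 0, modular ↦ 1) and `latticeTreeColoring_latticeTreeIso` (no inversions).

## References
* [Serre1980Trees] J.-P. Serre, *Trees* (1980), Ch. II §1.1 (the tree of `SL₂` over a local field: lattices, adjacency, distance from a base lattice).
* [Jacobowitz1962] R. Jacobowitz, *Hermitian forms over local fields*, Amer. J. Math. 84 (1962), §4, §7–§8 (unimodular and `𝔭`-modular hermitian lattices).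
* [BruhatTits1972] F. Bruhat, J. Tits, *Groupes réductifs sur un corps local I*, Publ. IHÉS 41 (1972), §10 (the building of a rank-one group is a tree).
* [Kottwitz1988] R. E. Kottwitz, *Tamagawa numbers*, Ann. of Math. 127 (1988), §2 (facets of the building and the Euler–Poincaré function).
-/

set_option autoImplicit false

noncomputable section

open scoped ValuativeRel Matrix MatrixGroups
open Matrix ValuativeRel

namespace Literature.NumberTheory.Automorphic.HermitianLatticeTree

variable {E : Type*} [Field E] [ValuativeRel E]

/-! ## §1 Lattices, scaling, the three types -/

/-- The `𝒪`-lattice `latt g ⊂ E²` spanned by the COLUMNS of `g ∈ M₂(E)` (the currency of ★ `FixedCosetsStableLattices`). [cite: Serre1980Trees, II.1.1] -/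
abbrev latt (g : Matrix (Fin 2) (Fin 2) E) : Submodule 𝒪[E] (Fin 2 → E) := Submodule.span 𝒪[E] (Set.range gᵀ)

/-- The homothetic lattice `c · M` (`c ∈ E`), as the image of `M` under the `𝒪`-linear map `x ↦ c • x`. [cite: Serre1980Trees, II.1.1] -/
def scaleLattice (c : E) (M : Submodule 𝒪[E] (Fin 2 → E)) : Submodule 𝒪[E] (Fin 2 → E) :=
  M.map ((c • (LinearMap.id : (Fin 2 → E) →ₗ[E] (Fin 2 → E))).restrictScalars 𝒪[E])

/-- A `2 × 2` matrix over `E` is UNIMODULAR if its entries are integral and its determinant has valuation `1` (⟺ it lies in `GL₂(𝒪)`, ★ `mem_glInt_of_isIntegralMatrix`).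
[cite: Jacobowitz1962, §7] -/
def IsUnimodular₂ (M : Matrix (Fin 2) (Fin 2) E) : Prop := (∀ i j, M i j ∈ 𝒪[E]) ∧ valuation E M.det = 1

/-- `M` is a SELF-DUAL lattice for the `σ`-hermitian form `H`: `M = latt g` with unimodular Gram matrix `(σg)ᵀ H g` (⟺ `M^∨ = M`). [cite: Jacobowitz1962, §7] -/
def IsSelfDualLattice (σ : E →+* E) (H : Matrix (Fin 2) (Fin 2) E) (M : Submodule 𝒪[E] (Fin 2 → E)) : Prop :=
  ∃ g : GL (Fin 2) E, M = latt (g : Matrix (Fin 2) (Fin 2) E) ∧ IsUnimodular₂ (formCongr σ g H)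

/-- `M` is a `ϖ`-MODULAR lattice for `H`: `M = latt g` with `ϖ⁻¹ · (σg)ᵀ H g` unimodular (⟺ `M^∨ = ϖ⁻¹ M`). [cite: Jacobowitz1962, §8] -/
def IsModularLattice (σ : E →+* E) (ϖ : E) (H : Matrix (Fin 2) (Fin 2) E) (M : Submodule 𝒪[E] (Fin 2 → E)) : Prop :=
  ∃ g : GL (Fin 2) E, M = latt (g : Matrix (Fin 2) (Fin 2) E) ∧ IsUnimodular₂ (ϖ⁻¹ • formCongr σ g H)

/-- A SPECIAL lattice: self-dual or `ϖ`-modular — the vertices of the tree. [cite: BruhatTits1972, §10] [cite: Jacobowitz1962, §7–§8] -/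
def IsSpecialLattice (σ : E →+* E) (ϖ : E) (H : Matrix (Fin 2) (Fin 2) E) (M : Submodule 𝒪[E] (Fin 2 → E)) : Prop :=
  IsSelfDualLattice σ H M ∨ IsModularLattice σ ϖ H M

/-! ## §2 The graph -/

/-- **The lattice tree of the hermitian plane `(E², H)`**: vertices the special lattices, an edge `L — Λ` iff `L` is self-dual, `Λ` is `ϖ`-modular and
`ϖ L ≤ Λ ≤ L` (at an inert place the Bruhat–Tits tree of `U(H)`, at a ramified place its barycentric subdivision). [cite: BruhatTits1972, §10] [cite: Serre1980Trees, II.1.1] -/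
def latticeTree (σ : E →+* E) (ϖ : E) (H : Matrix (Fin 2) (Fin 2) E) : SimpleGraph {M : Submodule 𝒪[E] (Fin 2 → E) // IsSpecialLattice σ ϖ H M} :=
  SimpleGraph.fromRel fun M N => IsSelfDualLattice σ H M.1 ∧ IsModularLattice σ ϖ H N.1 ∧ scaleLattice ϖ M.1 ≤ N.1 ∧ N.1 ≤ M.1

/-- Unfolding of the adjacency of `latticeTree`. [cite: Serre1980Trees, II.1.1] -/
theorem latticeTree_adj_iff (σ : E →+* E) (ϖ : E) (H : Matrix (Fin 2) (Fin 2) E)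
    (M N : {M : Submodule 𝒪[E] (Fin 2 → E) // IsSpecialLattice σ ϖ H M}) :
    (latticeTree σ ϖ H).Adj M N ↔ M ≠ N ∧
      ((IsSelfDualLattice σ H M.1 ∧ IsModularLattice σ ϖ H N.1 ∧ scaleLattice ϖ M.1 ≤ N.1 ∧ N.1 ≤ M.1) ∨
       (IsSelfDualLattice σ H N.1 ∧ IsModularLattice σ ϖ H M.1 ∧ scaleLattice ϖ N.1 ≤ M.1 ∧ M.1 ≤ N.1)) := by
  rw [latticeTree, SimpleGraph.fromRel_adj]

/-! ## §3 Depth and parent towards the root `L₀ = 𝒪²` -/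

/-- The DEPTH of a lattice `M` below the root `L₀ = latt 1 = 𝒪²`: the least `k : ℕ` with `ϖ^k L₀ ≤ M` (`0` if there is none — never the case for a lattice
`latt g`).  A self-dual lattice of depth `k` is at distance `2k` from `L₀` in the tree, a `ϖ`-modular one at distance `2k − 1`. [cite: Serre1980Trees, II.1.1] -/
def latticeDepth (ϖ : E) (M : Submodule 𝒪[E] (Fin 2 → E)) : ℕ :=
  sInf {k : ℕ | scaleLattice (ϖ ^ k) (latt (1 : Matrix (Fin 2) (Fin 2) E)) ≤ M}

open Classical in
/-- The PARENT of a special lattice `M` of depth `k ≥ 1` — its neighbour towards the root: `M ⊓ ϖ^{1−k} L₀` for self-dual `M`, `ϖ⁻¹M ⊓ ϖ^{1−k} L₀` for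
`ϖ`-modular `M` (uniformly `M^♮ ⊓ ϖ^{1−k}L₀` with `M^♮` the dual lattice).  [cite: Serre1980Trees, II.1.1] -/
def latticeParent (σ : E →+* E) (ϖ : E) (H : Matrix (Fin 2) (Fin 2) E) (M : Submodule 𝒪[E] (Fin 2 → E)) : Submodule 𝒪[E] (Fin 2 → E) :=
  (if IsSelfDualLattice σ H M then M else scaleLattice ϖ⁻¹ M) ⊓
    scaleLattice (ϖ ^ (1 - (latticeDepth ϖ M : ℤ))) (latt (1 : Matrix (Fin 2) (Fin 2) E))


/-! ## §3b Images and scaling commute -/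

section Images

/-- `latt (P g) = P · latt g`. [cite: Serre1980Trees, II.1.1] -/
theorem latt_mul (P g : Matrix (Fin 2) (Fin 2) E) :
    latt (P * g) = (latt g).map ((Matrix.toLin' P).restrictScalars 𝒪[E]) :=
  span_range_transpose_mul P g

/-- Scaling commutes with images under `P ∈ M₂(E)`. [cite: Serre1980Trees, II.1.1] -/
theorem scaleLattice_map (c : E) (P : Matrix (Fin 2) (Fin 2) E) (M : Submodule 𝒪[E] (Fin 2 → E)) :
    scaleLattice c (M.map ((Matrix.toLin' P).restrictScalars 𝒪[E])) = (scaleLattice c M).map ((Matrix.toLin' P).restrictScalars 𝒪[E]) := by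
  rw [scaleLattice, scaleLattice, ← Submodule.map_comp, ← Submodule.map_comp]
  congr 1
  apply LinearMap.ext
  intro x
  simp

end Images

/-! ## §3c The action of `U(σ, H)` on the graph: a colour-preserving graph automorphism -/

section Action

variable (σ : E →+* E) (hσv : ∀ x : E, valuation E (σ x) = valuation E x) (ϖ : E) (H : Matrix (Fin 2) (Fin 2) E)

/-- The image of a lattice under `g ∈ GL₂(E)`. [cite: Serre1980Trees, II.1.1] -/
def mapGL (g : GL (Fin 2) E) (M : Submodule 𝒪[E] (Fin 2 → E)) : Submodule 𝒪[E] (Fin 2 → E) :=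
  M.map ((Matrix.toLin' (g : Matrix (Fin 2) (Fin 2) E)).restrictScalars 𝒪[E])

/-- `g · latt h = latt (g h)`. [cite: Serre1980Trees, II.1.1] -/
theorem mapGL_latt (g h : GL (Fin 2) E) : mapGL g (latt (h : Matrix (Fin 2) (Fin 2) E)) = latt ((g * h : GL (Fin 2) E) : Matrix (Fin 2) (Fin 2) E) := by
  rw [mapGL, Units.val_mul, latt_mul]

/-- `(g h) · M = g · (h · M)`. [cite: Serre1980Trees, II.1.1] -/
theorem mapGL_mul (g h : GL (Fin 2) E) (M : Submodule 𝒪[E] (Fin 2 → E)) : mapGL (g * h) M = mapGL g (mapGL h M) := by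
  rw [mapGL, mapGL, mapGL, ← Submodule.map_comp]
  congr 1
  apply LinearMap.ext; intro x
  simp

/-- `1 · M = M`. [cite: Serre1980Trees, II.1.1] -/
theorem mapGL_one (M : Submodule 𝒪[E] (Fin 2 → E)) : mapGL 1 M = M := by
  rw [mapGL]
  convert Submodule.map_id M
  apply LinearMap.ext; intro x
  simp

/-- `g ·` is monotone and order-reflecting. [cite: Serre1980Trees, II.1.1] -/
theorem mapGL_le_mapGL_iff (g : GL (Fin 2) E) (M N : Submodule 𝒪[E] (Fin 2 → E)) : mapGL g M ≤ mapGL g N ↔ M ≤ N := by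
  constructor
  · intro h
    have h' := Submodule.map_mono (f := (Matrix.toLin' ((g⁻¹ : GL (Fin 2) E) : Matrix (Fin 2) (Fin 2) E)).restrictScalars 𝒪[E]) h
    change mapGL g⁻¹ (mapGL g M) ≤ mapGL g⁻¹ (mapGL g N) at h'
    rwa [← mapGL_mul, ← mapGL_mul, inv_mul_cancel, mapGL_one, mapGL_one] at h'
  · exact fun h => Submodule.map_mono h

/-- `g ·` commutes with scaling. [cite: Serre1980Trees, II.1.1] -/
theorem mapGL_scaleLattice (g : GL (Fin 2) E) (c : E) (M : Submodule 𝒪[E] (Fin 2 → E)) : mapGL g (scaleLattice c M) = scaleLattice c (mapGL g M) := by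
  rw [mapGL, mapGL, scaleLattice_map]

omit [ValuativeRel E] in
/-- A unitary `u` preserves Gram matrices: `formCongr σ (u g) H = formCongr σ g H`. [cite: Jacobowitz1962, §4] -/
theorem formCongr_unitary_mul (u : GL (Fin 2) E) (hu : u ∈ unitaryGroupOfForm σ H) (g : GL (Fin 2) E) : formCongr σ (u * g) H = formCongr σ g H := by
  have hu' : ((u : Matrix (Fin 2) (Fin 2) E).map σ)ᵀ * H * (u : Matrix (Fin 2) (Fin 2) E) = H := hu
  simp only [formCongr, Units.val_mul, Matrix.map_mul, Matrix.transpose_mul]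
  rw [show ((g : Matrix (Fin 2) (Fin 2) E).map σ)ᵀ * ((u : Matrix (Fin 2) (Fin 2) E).map σ)ᵀ * H * ((u : Matrix (Fin 2) (Fin 2) E) * (g : Matrix (Fin 2) (Fin 2) E)) =
    ((g : Matrix (Fin 2) (Fin 2) E).map σ)ᵀ * ((((u : Matrix (Fin 2) (Fin 2) E).map σ)ᵀ * H * (u : Matrix (Fin 2) (Fin 2) E))) * (g : Matrix (Fin 2) (Fin 2) E) by
      simp only [Matrix.mul_assoc], hu']

/-- A unitary `u` maps self-dual lattices to self-dual lattices. [cite: Jacobowitz1962, §7] -/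
theorem isSelfDualLattice_mapGL (u : GL (Fin 2) E) (hu : u ∈ unitaryGroupOfForm σ H) {M : Submodule 𝒪[E] (Fin 2 → E)}
    (hM : IsSelfDualLattice σ H M) : IsSelfDualLattice σ H (mapGL u M) := by
  obtain ⟨g, rfl, hg⟩ := hM
  exact ⟨u * g, mapGL_latt u g, by rwa [formCongr_unitary_mul σ H u hu]⟩

/-- A unitary `u` maps `ϖ`-modular lattices to `ϖ`-modular lattices. [cite: Jacobowitz1962, §8] -/
theorem isModularLattice_mapGL (u : GL (Fin 2) E) (hu : u ∈ unitaryGroupOfForm σ H) {M : Submodule 𝒪[E] (Fin 2 → E)}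
    (hM : IsModularLattice σ ϖ H M) : IsModularLattice σ ϖ H (mapGL u M) := by
  obtain ⟨g, rfl, hg⟩ := hM
  exact ⟨u * g, mapGL_latt u g, by rwa [formCongr_unitary_mul σ H u hu]⟩

/-- A unitary `u` maps special lattices to special lattices. [cite: BruhatTits1972, §10] -/
theorem isSpecialLattice_mapGL (u : GL (Fin 2) E) (hu : u ∈ unitaryGroupOfForm σ H) {M : Submodule 𝒪[E] (Fin 2 → E)}
    (hM : IsSpecialLattice σ ϖ H M) : IsSpecialLattice σ ϖ H (mapGL u M) := by
  rcases hM with h | h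
  · exact Or.inl (isSelfDualLattice_mapGL σ H u hu h)
  · exact Or.inr (isModularLattice_mapGL σ ϖ H u hu h)

/-- **The action of `u ∈ U(σ, H)` on the vertices of the tree**, as a permutation. [cite: BruhatTits1972, §10] -/
def latticeTreePerm (u : unitaryGroupOfForm σ H) :
    {M : Submodule 𝒪[E] (Fin 2 → E) // IsSpecialLattice σ ϖ H M} ≃ {M : Submodule 𝒪[E] (Fin 2 → E) // IsSpecialLattice σ ϖ H M} where
  toFun v := ⟨mapGL (u : GL (Fin 2) E) v.1, isSpecialLattice_mapGL σ ϖ H _ u.2 v.2⟩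
  invFun v := ⟨mapGL ((u⁻¹ : unitaryGroupOfForm σ H) : GL (Fin 2) E) v.1, isSpecialLattice_mapGL σ ϖ H _ (u⁻¹).2 v.2⟩
  left_inv v := by apply Subtype.ext; change mapGL _ (mapGL _ v.1) = v.1; rw [← mapGL_mul, Subgroup.coe_inv, inv_mul_cancel, mapGL_one]
  right_inv v := by apply Subtype.ext; change mapGL _ (mapGL _ v.1) = v.1; rw [← mapGL_mul, Subgroup.coe_inv, mul_inv_cancel, mapGL_one]

/-- **`u ∈ U(σ, H)` ACTS ON THE TREE BY A GRAPH AUTOMORPHISM** (it preserves the two types, inclusions and scaling). [cite: BruhatTits1972, §10] [cite: Serre1980Trees, II.1.1] -/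
def latticeTreeIso (u : unitaryGroupOfForm σ H) : latticeTree σ ϖ H ≃g latticeTree σ ϖ H where
  toEquiv := latticeTreePerm σ ϖ H u
  map_rel_iff' := by
    intro v w
    change (latticeTree σ ϖ H).Adj ⟨mapGL (u : GL (Fin 2) E) v.1, _⟩ ⟨mapGL (u : GL (Fin 2) E) w.1, _⟩ ↔ (latticeTree σ ϖ H).Adj v w
    rw [latticeTree_adj_iff, latticeTree_adj_iff]
    have hinj : ∀ {a b : {M : Submodule 𝒪[E] (Fin 2 → E) // IsSpecialLattice σ ϖ H M}},
        (⟨mapGL (u : GL (Fin 2) E) a.1, isSpecialLattice_mapGL σ ϖ H _ u.2 a.2⟩ : {M : Submodule 𝒪[E] (Fin 2 → E) // IsSpecialLattice σ ϖ H M}) =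
          ⟨mapGL (u : GL (Fin 2) E) b.1, isSpecialLattice_mapGL σ ϖ H _ u.2 b.2⟩ ↔ a = b :=
      fun {a b} => (latticeTreePerm σ ϖ H u).injective.eq_iff
    have hsd : ∀ {M : Submodule 𝒪[E] (Fin 2 → E)}, IsSelfDualLattice σ H (mapGL (u : GL (Fin 2) E) M) ↔ IsSelfDualLattice σ H M := by
      intro M; constructor
      · intro h
        have h' := isSelfDualLattice_mapGL σ H _ (u⁻¹).2 h
        rwa [← mapGL_mul, Subgroup.coe_inv, inv_mul_cancel, mapGL_one] at h'
      · exact isSelfDualLattice_mapGL σ H _ u.2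
    have hmd : ∀ {M : Submodule 𝒪[E] (Fin 2 → E)}, IsModularLattice σ ϖ H (mapGL (u : GL (Fin 2) E) M) ↔ IsModularLattice σ ϖ H M := by
      intro M; constructor
      · intro h
        have h' := isModularLattice_mapGL σ ϖ H _ (u⁻¹).2 h
        rwa [← mapGL_mul, Subgroup.coe_inv, inv_mul_cancel, mapGL_one] at h'
      · exact isModularLattice_mapGL σ ϖ H _ u.2
    simp only [ne_eq, hinj, ← mapGL_scaleLattice, mapGL_le_mapGL_iff, hsd, hmd]

/-- The automorphism on underlying lattices: `(latticeTreeIso u v).1 = u · v.1`. [cite: BruhatTits1972, §10] -/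
theorem latticeTreeIso_apply_coe (u : unitaryGroupOfForm σ H) (v : {M : Submodule 𝒪[E] (Fin 2 → E) // IsSpecialLattice σ ϖ H M}) :
    ((latticeTreeIso σ ϖ H u v : {M : Submodule 𝒪[E] (Fin 2 → E) // IsSpecialLattice σ ϖ H M}) : Submodule 𝒪[E] (Fin 2 → E)) =
      v.1.map ((Matrix.toLin' ((u : GL (Fin 2) E) : Matrix (Fin 2) (Fin 2) E)).restrictScalars 𝒪[E]) := rfl

variable {σ ϖ H}

open Classical in
/-- **The type colouring**: self-dual ↦ `0`, `ϖ`-modular ↦ `1` is a proper `2`-colouring of the graph (edges join the two types), granted that no lattice has both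
types (`hdisj`; automatic for a uniformizer `ϖ` and a valuation-preserving `σ`, see `not_isModularLattice_of_isSelfDualLattice`). [cite: BruhatTits1972, §10] -/
def latticeTreeColoring (hdisj : ∀ M : Submodule 𝒪[E] (Fin 2 → E), IsSelfDualLattice σ H M → IsModularLattice σ ϖ H M → False) :
    (latticeTree σ ϖ H).Coloring (Fin 2) :=
  SimpleGraph.Coloring.mk (fun v => if IsSelfDualLattice σ H v.1 then 0 else 1) (by
    intro v w hvw
    rw [latticeTree_adj_iff] at hvw
    obtain ⟨-, h⟩ := hvw
    rcases h with ⟨hv, hw, -, -⟩ | ⟨hw, hv, -, -⟩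
    · have hw' : ¬ IsSelfDualLattice σ H w.1 := fun h => hdisj _ h hw
      simp [hv, hw']
    · have hv' : ¬ IsSelfDualLattice σ H v.1 := fun h => hdisj _ h hv
      simp [hw, hv'])

/-- The unitary action preserves the type colouring (no inversions). [cite: BruhatTits1972, §10] -/
theorem latticeTreeColoring_latticeTreeIso (hdisj : ∀ M : Submodule 𝒪[E] (Fin 2 → E), IsSelfDualLattice σ H M → IsModularLattice σ ϖ H M → False)
    (u : unitaryGroupOfForm σ H) (v : {M : Submodule 𝒪[E] (Fin 2 → E) // IsSpecialLattice σ ϖ H M}) :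
    latticeTreeColoring hdisj (latticeTreeIso σ ϖ H u v) = latticeTreeColoring hdisj v := by
  classical
  have hsd : IsSelfDualLattice σ H (mapGL (u : GL (Fin 2) E) v.1) ↔ IsSelfDualLattice σ H v.1 := by
    constructor
    · intro h
      have h' := isSelfDualLattice_mapGL σ H _ (u⁻¹).2 h
      rwa [← mapGL_mul, Subgroup.coe_inv, inv_mul_cancel, mapGL_one] at h'
    · exact isSelfDualLattice_mapGL σ H _ u.2
  change (if IsSelfDualLattice σ H (mapGL (u : GL (Fin 2) E) v.1) then (0 : Fin 2) else 1) = if IsSelfDualLattice σ H v.1 then 0 else 1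
  simp only [hsd]

end Action

end Literature.NumberTheory.Automorphic.HermitianLatticeTree

end
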